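import Summits.CriticalPhenomena.CardyFormulaZ2.Theorems.CardyComplexConeEdgePrecompactUFRSExteriorWinding
import Summits.CriticalPhenomena.CardyFormulaZ2.Theorems.CardyComplexConeEdgePrecompactUFRSTwoArcSurround
import Summits.CriticalPhenomena.CardyFormulaZ2.Theorems.CardyComplexConeEdgePrecompactUFRSArmDomination

/-!
# The turning of the full exploration is canonical (Lemma A of the START-pair analysis)
(line `qkz-strip-boundary-arm` of crux `CardyComplexCone.EdgePrecompact`, stmt-CriticalPhenomena-11387;
third file of the trail-based planar analysis of the START-pair residual shared by
`ufrs_initialContactCase_certJ` and `ufrs_slippedReturnCase_certJ`, after `…UFRSExteriorClosing.lean`,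
`…UFRSExteriorWinding.lean`)

For an admissible datum `E` of a Jordan Dobrushin domain and its translate `shiftData E w`, consider the
FULL explorations: the orbit `O₀ a [0, K₀]` of the start corner `a` of `E` under `β₀ = E.bcBondConfig ω`
through inner faces of `E` up to its exit (face at `K₀ + 1` not inner), and the orbit `O₁ a' [0, K₁]` of
the start corner `a'` of the translate under `β₁ = (shiftData E w).bcBondConfig ω` up to its exit.

* `ufrs_canonicalTurning_ST` (registered): `∑_{t < K₀} turnSign β₀ (O₀ a t) = ∑_{t < K₁} turnSign β₁ (O₁ a' t)`
  — the total turning of a full exploration does not depend on the configuration, nor on the shift.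

PROOF. `a' = (a.1 + w, a.2)` (`eq_shift_of_isStartCorner`) and the two exit corners are THE exit corners,
translates of each other (`orbit_exitCorner`, `runEnd_exitType_W3H`, `exitType_sub_shift_W3H`); both
exit steps are left turns into the outer face of `e_b` (+`w`). Close the exploration of `E` by an exterior
corner path `κ` from the corner after the exit to the corner `(a.1, a.2 + 3)` before the start
(`ufrs_exteriorClosing_ST`): in medial coordinates this is a closed TRAIL `T₀` (`glueSeq`; darts of distinct
corners are distinct, inner and non-inner corners differ). The translate's exploration shifted back by `w`
and closed by the SAME `κ` is a closed trail `T₁` with the same first dart (the dart of `a`) and the same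
tail. By the two-trail comparison `twoTrail_turn_sub_SR` the difference of the two turn sums is `4 ×` the
difference of the winding contributions of the two arcs at the two faces of the dart of `a`; that
difference chain (forward darts of the first arc, reversed darts of the second) is a closed chain
supported on corners with INNER faces of `E` (`isInnerFace_shiftData_iff`), so by the exterior winding
lemma `ufrs_exteriorWinding_ST` it has winding `0` at the medial face of the start vertex `a.1` (a vertex
of the outer face of `e_a`), which is the LEFT face of the dart of `a`; the right face carries the same
value because the dart of `a` occurs once in each arc (jump `dwnd_rf_sub_lf_ST`).

Consequence used downstream (not restated here): in the START-pair final-merge configuration the offset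
`∑_{t<n} turn₀ - ∑_{t<T} turn₁` of the two start strands at the common deep corner equals the offset of
the two CONTINUATIONS from that corner to the exits.

References: H. Hopf, Compositio Math. 2 (1935), Satz I; S. Smirnov, Ann. of Math. 172 (2010), §4.
-/

set_option linter.unusedVariables false

namespace Summit.CriticalPhenomena.CardyFormulaZ2.Cruxes.EdgePrecompact.QkzStripBoundaryArm

open MeasureTheory Filter Set Metric
open scoped Topology BigOperators Pointwise
open Literature.Probability.LatticeModels Literature.Probability.Percolation
open Literature.Probability.LatticeModels.MedialTrail
open Literature.Probability.RandomPlanarGeometry (DobrushinDomain)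
open Summit.CriticalPhenomena.CardyFormulaZ2.Theses.CardyComplexCone

noncomputable section

/-! ## Lemma A -/

/-- **The turning of the full exploration is canonical** (registered helper `ufrs_canonicalTurning_ST` of
stmt-CriticalPhenomena-11387). DATA: an admissible datum `E` of the Jordan Dobrushin domain `D`, a shift
`w`, two configurations `ω₀`, `ω₁`, the start corners `a` of `E` and `a'` of `shiftData E w`, and the exit
times `K₀`, `K₁` of the two explorations (`O₀ a t`, `t ≤ K₀`, in inner faces of `E` and `O₀ a (K₀ + 1)`
not; likewise for the translate). CONCLUSION: the two turn sums up to the exits agree,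
`∑_{t<K₀} turnSign β₀ (O₀ a t) = ∑_{t<K₁} turnSign β₁ (O₁ a' t)`. See the module docstring for the proof. -/
theorem ufrs_canonicalTurning_ST : ∀ (D : DobrushinDomain) (E : DiscreteDobrushin), E.Ω = D.carrier → E.IsZdAdmissible → ∀ (w : Site 2) (ω₀ ω₁ : BondConfig (Site 2)) (a a' : Site 2 × Fin 4) (K₀ K₁ : ℕ), E.IsStartCorner a → (shiftData E w).IsStartCorner a' → (∀ t ≤ K₀, E.IsInnerFace (cFace (cornerOrbit (E.bcBondConfig ω₀) a t))) → ¬ E.IsInnerFace (cFace (cornerOrbit (E.bcBondConfig ω₀) a (K₀ + 1))) → (∀ t ≤ K₁, (shiftData E w).IsInnerFace (cFace (cornerOrbit ((shiftData E w).bcBondConfig ω₁) a' t))) → ¬ (shiftData E w).IsInnerFace (cFace (cornerOrbit ((shiftData E w).bcBondConfig ω₁) a' (K₁ + 1))) → ∑ t ∈ Finset.range K₀, turnSign (E.bcBondConfig ω₀) (cornerOrbit (E.bcBondConfig ω₀) a t) = ∑ t ∈ Finset.range K₁, turnSign ((shiftData E w).bcBondConfig ω₁) (cornerOrbit ((shiftData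 E w).bcBondConfig ω₁) a' t) := by
  intro D E hΩ hE w ω₀ ω₁ a a' K₀ K₁ ha ha' hin₀ hout₀ hin₁ hout₁
  classical
  have hE₁ : (shiftData E w).IsZdAdmissible := isZdAdmissible_shiftData E w hE
  set β₀ := E.bcBondConfig ω₀ with hβ₀
  set β₁ := (shiftData E w).bcBondConfig ω₁ with hβ₁
  have ha'eq : a' = (a.1 + w, a.2) := eq_shift_of_isStartCorner hE ha ha'
  -- the two exit corners are THE exit corners, translates of each other; both exit steps turn left
  set q₀ := cornerOrbit β₀ a K₀ with hq₀
  set q₁ := cornerOrbit β₁ a' K₁ with hq₁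
  have haB : a.1 ∉ E.zdArcB := Set.disjoint_left.1 hE.disjoint ha.mem_zdArcA
  have ha'B : a'.1 ∉ (shiftData E w).zdArcB := Set.disjoint_left.1 hE₁.disjoint ha'.mem_zdArcA
  obtain ⟨hclosed₀, -, -, -, -, -, huniq₀⟩ := orbit_exitCorner hE ω₀ a haB (hin₀ K₀ le_rfl) hout₀
  obtain ⟨hclosed₁, hA₁, hB₁, hIn₁, -⟩ := runEnd_exitType_W3H hE ω₁ w (hin₁ K₁ le_rfl) hout₁ (Or.inl ha'B)
  obtain ⟨hA₁', hB₁', hIn₁'⟩ := exitType_sub_shift_W3H hA₁ hB₁ hIn₁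
  have hq : ((q₁.1 - w, q₁.2) : Site 2 × Fin 4) = q₀ := huniq₀ (q₁.1 - w, q₁.2) hA₁' hB₁' hIn₁'
  set x₀ := cornerOrbit β₀ a (K₀ + 1) with hx₀
  have hx₀eq : x₀ = (q₀.1, q₀.2 + 1) := by rw [hx₀, cornerOrbit_succ, ← hq₀, nextCorner_of_not_mem hclosed₀]
  have hx₁eq : cornerOrbit β₁ a' (K₁ + 1) = (q₁.1, q₁.2 + 1) := by rw [cornerOrbit_succ, ← hq₁, nextCorner_of_not_mem hclosed₁]
  -- the corner before the start and the exterior closing path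
  set pa : Site 2 × Fin 4 := (a.1, a.2 + 3) with hpa
  have hpa_out : ¬ E.IsInnerFace (cFace pa) := ha.isOutEdge.2
  have hpa_a : ((pa.1, pa.2 + 1) : Site 2 × Fin 4) = a := by
    rw [hpa]; exact Prod.ext rfl (by show a.2 + 3 + 1 = a.2; have := fin4_add_one_add_three a.2; revert this; generalize a.2 = k; revert k; decide)
  obtain ⟨κ, M, hκ0, hκM, hκstep, hκout, hκinj⟩ := ufrs_exteriorClosing_ST D E hΩ hE x₀ pa hout₀ hpa_out
  -- medial sequences
  set P₀ : ℕ → Pt := fun m => cpos (cornerOrbit β₀ a m) with hP₀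
  set P₁ : ℕ → Pt := fun m => unshift w (cpos (cornerOrbit β₁ a' m)) with hP₁
  set Kp : ℕ → Pt := fun u => if u ≤ M then cpos (κ u) else cpos a with hKp
  -- their darts are darts of corners
  have hP₀d : ∀ m, (P₀ m, P₀ (m + 1)) = cornerDart (cornerOrbit β₀ a m) := fun m => by
    rw [hP₀]; exact (cornerDart_eq β₀ _).symm
  have hP₁d : ∀ m, (P₁ m, P₁ (m + 1)) = cornerDart ((cornerOrbit β₁ a' m).1 - w, (cornerOrbit β₁ a' m).2) := fun m => by
    rw [hP₁]; exact unshift_step_ST w β₁ _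
  have hKpd : ∀ u < M + 1, (Kp u, Kp (u + 1)) = cornerDart (κ u) := by
    intro u hu
    show ((if u ≤ M then cpos (κ u) else cpos a), (if u + 1 ≤ M then cpos (κ (u + 1)) else cpos a)) = cornerDart (κ u)
    rcases Nat.lt_or_ge u M with h | h
    · rw [if_pos h.le, if_pos (Nat.succ_le_of_lt h)]
      exact freeStep_dart_ST (hκstep u h)
    · have huM : u = M := by omega
      subst huM
      rw [if_pos le_rfl, if_neg (Nat.not_succ_le_self _), hκM, ← hpa_a]
      exact freeStep_dart_ST (Or.inl rfl)
  -- endpoints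
  have hK0₀ : Kp 0 = P₀ (K₀ + 1) := by
    show (if 0 ≤ M then cpos (κ 0) else cpos a) = cpos (cornerOrbit β₀ a (K₀ + 1))
    rw [if_pos (Nat.zero_le _), hκ0]
  have hK0₁ : Kp 0 = P₁ (K₁ + 1) := by
    show (if 0 ≤ M then cpos (κ 0) else cpos a) = unshift w (cpos (cornerOrbit β₁ a' (K₁ + 1)))
    rw [if_pos (Nat.zero_le _), hκ0, unshift_cpos_ST, hx₁eq, hx₀eq, ← hq]
  have hKM₀ : Kp (M + 1) = P₀ 0 := by
    show (if M + 1 ≤ M then cpos (κ (M + 1)) else cpos a) = cpos (cornerOrbit β₀ a 0)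
    rw [if_neg (Nat.not_succ_le_self _)]; rfl
  have hKM₁ : Kp (M + 1) = P₁ 0 := by
    show (if M + 1 ≤ M then cpos (κ (M + 1)) else cpos a) = unshift w (cpos (cornerOrbit β₁ a' 0))
    rw [if_neg (Nat.not_succ_le_self _), unshift_cpos_ST, cornerOrbit_zero, ha'eq]
    simp
  -- faces: the arc corners are inner for `E`, the closing corners are not
  have hinner₁ : ∀ m ≤ K₁, E.IsInnerFace (cFace ((cornerOrbit β₁ a' m).1 - w, (cornerOrbit β₁ a' m).2)) := by
    intro m hm
    rw [cFace_sub_ST, ← isInnerFace_shiftData_iff (E := E) (w := w), sub_add_cancel]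
    exact hin₁ m hm
  -- the two closed trails
  have hT₀ : IsTrail ((List.range (K₀ + (M + 1 + 1))).map (glueSeq P₀ K₀ Kp (M + 1))) := by
    refine isTrail_glue_darts_ST (fun m _ => by rw [hP₀]; exact isDart_cpos β₀ _)
      (fun u hu => by have := isDart_cornerDart (κ u); rw [← hKpd u hu] at this; exact this) hK0₀ hKM₀ ?_ ?_ ?_
    · intro m hm m' hm' h
      rw [hP₀d, hP₀d] at h
      have hc := cornerDart_injective h
      by_contra hne
      rcases Nat.lt_or_gt_of_ne hne with hlt | hlt
      · exact cornerOrbit_ne hE ha hlt (fun k hk => hin₀ k (by omega)) hc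
      · exact cornerOrbit_ne hE ha hlt (fun k hk => hin₀ k (by omega)) hc.symm
    · intro u hu u' hu' h
      rw [hKpd u hu, hKpd u' hu'] at h
      exact hκinj u u' (by omega) (by omega) (cornerDart_injective h)
    · intro m hm u hu h
      rw [hP₀d, hKpd u hu] at h
      have hc := cornerDart_injective h
      exact hκout u (by omega) (by rw [← hc]; exact hin₀ m hm)
  have hT₁ : IsTrail ((List.range (K₁ + (M + 1 + 1))).map (glueSeq P₁ K₁ Kp (M + 1))) := by
    refine isTrail_glue_darts_ST (fun m _ => by have := isDart_cornerDart ((cornerOrbit β₁ a' m).1 - w, (cornerOrbit β₁ a' m).2); rw [← hP₁d m] at this; exact this)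
      (fun u hu => by have := isDart_cornerDart (κ u); rw [← hKpd u hu] at this; exact this) hK0₁ hKM₁ ?_ ?_ ?_
    · intro m hm m' hm' h
      rw [hP₁d, hP₁d] at h
      have hc := cornerDart_injective h
      simp only [Prod.mk.injEq, sub_left_inj] at hc
      have hc' : cornerOrbit β₁ a' m = cornerOrbit β₁ a' m' := Prod.ext hc.1 hc.2
      by_contra hne
      rcases Nat.lt_or_gt_of_ne hne with hlt | hlt
      · exact cornerOrbit_ne hE₁ ha' hlt (fun k hk => hin₁ k (by omega)) hc'
      · exact cornerOrbit_ne hE₁ ha' hlt (fun k hk => hin₁ k (by omega)) hc'.symm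
    · intro u hu u' hu' h
      rw [hKpd u hu, hKpd u' hu'] at h
      exact hκinj u u' (by omega) (by omega) (cornerDart_injective h)
    · intro m hm u hu h
      rw [hP₁d, hKpd u hu] at h
      have hc := cornerDart_injective h
      exact hκout u (by omega) (by rw [← hc]; exact hinner₁ m hm)
  -- the two-trail comparison
  have e₀ : K₀ + (M + 1 + 1) = K₀ + 1 + (M + 1) := by omega
  have e₁ : K₁ + (M + 1 + 1) = K₁ + 1 + (M + 1) := by omega
  rw [e₀] at hT₀
  rw [e₁] at hT₁
  have h0 : glueSeq P₀ K₀ Kp (M + 1) 0 = glueSeq P₁ K₁ Kp (M + 1) 0 := by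
    rw [glueSeq_of_le_SR (by omega), glueSeq_of_le_SR (by omega), ← hKM₀, ← hKM₁]
  have h1 : glueSeq P₀ K₀ Kp (M + 1) 1 = glueSeq P₁ K₁ Kp (M + 1) 1 := by
    rw [glueSeq_of_le_SR (by omega), glueSeq_of_le_SR (by omega)]
    have e0 := congrArg Prod.snd (hP₀d 0)
    have e1 := congrArg Prod.snd (hP₁d 0)
    simp only at e0 e1
    rw [e0, e1, cornerOrbit_zero, cornerOrbit_zero, ha'eq]
    simp
  have hper₀ : glueSeq P₀ K₀ Kp (M + 1) (K₀ + 1 + (M + 1)) = glueSeq P₀ K₀ Kp (M + 1) 0 := by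
    rw [← e₀]; exact glueSeq_period_SR hK0₀ hKM₀
  have hper₁ : glueSeq P₁ K₁ Kp (M + 1) (K₁ + 1 + (M + 1)) = glueSeq P₁ K₁ Kp (M + 1) 0 := by
    rw [← e₁]; exact glueSeq_period_SR hK0₁ hKM₁
  have hper₀' : glueSeq P₀ K₀ Kp (M + 1) (K₀ + 1 + (M + 1) + 1) = glueSeq P₀ K₀ Kp (M + 1) 1 := by
    rw [← e₀]; exact glueSeq_period_succ_SR
  have hper₁' : glueSeq P₁ K₁ Kp (M + 1) (K₁ + 1 + (M + 1) + 1) = glueSeq P₁ K₁ Kp (M + 1) 1 := by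
    rw [← e₁]; exact glueSeq_period_succ_SR
  have htail : ∀ u ≤ M + 1 + 1, glueSeq P₀ K₀ Kp (M + 1) (K₀ + 1 + u) = glueSeq P₁ K₁ Kp (M + 1) (K₁ + 1 + u) := by
    intro u hu
    rcases Nat.lt_or_ge u (M + 1 + 1) with h | h
    · rw [glueSeq_path_SR hK0₀ (show u ≤ M + 1 by omega), glueSeq_path_SR hK0₁ (show u ≤ M + 1 by omega)]
    · have hu' : u = M + 1 + 1 := by omega
      rw [hu', show K₀ + 1 + (M + 1 + 1) = K₀ + 1 + (M + 1) + 1 by omega,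
        show K₁ + 1 + (M + 1 + 1) = K₁ + 1 + (M + 1) + 1 by omega, hper₀', hper₁', h1]
  have key := twoTrail_turn_sub_SR (glueSeq P₀ K₀ Kp (M + 1)) (glueSeq P₁ K₁ Kp (M + 1)) (K₀ + 1) (K₁ + 1) (M + 1)
    (by omega) hT₀ hT₁ hper₀ hper₀' hper₁ hper₁' h0 h1 htail
  -- LEFT-HAND SIDE: the turn sums of the two explorations plus a common last term
  have hG₀ : ∀ m ≤ K₀ + 1, glueSeq P₀ K₀ Kp (M + 1) m = P₀ m := fun m hm => glueSeq_of_le_SR hm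
  have hG₁ : ∀ m ≤ K₁ + 1, glueSeq P₁ K₁ Kp (M + 1) m = P₁ m := fun m hm => glueSeq_of_le_SR hm
  have hG₀' : glueSeq P₀ K₀ Kp (M + 1) (K₀ + 2) = Kp 1 := glueSeq_path_SR hK0₀ (show 1 ≤ M + 1 by omega)
  have hG₁' : glueSeq P₁ K₁ Kp (M + 1) (K₁ + 2) = Kp 1 := glueSeq_path_SR hK0₁ (show 1 ≤ M + 1 by omega)
  have hlast : turn (P₀ K₀) (P₀ (K₀ + 1)) (Kp 1) = turn (P₁ K₁) (P₁ (K₁ + 1)) (Kp 1) := by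
    rw [← hK0₀, ← hK0₁]
    have e1 : P₁ K₁ = P₀ K₀ := by
      show unshift w (cpos (cornerOrbit β₁ a' K₁)) = cpos (cornerOrbit β₀ a K₀)
      rw [unshift_cpos_ST, ← hq₁, ← hq₀, ← hq]
    rw [e1]
  have hL₀ : ∑ m ∈ Finset.range (K₀ + 1), turn (glueSeq P₀ K₀ Kp (M + 1) m) (glueSeq P₀ K₀ Kp (M + 1) (m + 1)) (glueSeq P₀ K₀ Kp (M + 1) (m + 2)) =
      ∑ t ∈ Finset.range K₀, turnSign β₀ (cornerOrbit β₀ a t) + turn (P₀ K₀) (P₀ (K₀ + 1)) (Kp 1) := by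
    rw [Finset.sum_range_succ, hG₀ K₀ (by omega), hG₀ (K₀ + 1) le_rfl, hG₀']
    congr 1
    refine Finset.sum_congr rfl fun m hm => ?_
    rw [Finset.mem_range] at hm
    rw [hG₀ m (by omega), hG₀ (m + 1) (by omega), hG₀ (m + 2) (by omega)]
    exact turn_cpos β₀ _
  have hL₁ : ∑ m ∈ Finset.range (K₁ + 1), turn (glueSeq P₁ K₁ Kp (M + 1) m) (glueSeq P₁ K₁ Kp (M + 1) (m + 1)) (glueSeq P₁ K₁ Kp (M + 1) (m + 2)) =
      ∑ t ∈ Finset.range K₁, turnSign β₁ (cornerOrbit β₁ a' t) + turn (P₁ K₁) (P₁ (K₁ + 1)) (Kp 1) := by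
    rw [Finset.sum_range_succ, hG₁ K₁ (by omega), hG₁ (K₁ + 1) le_rfl, hG₁']
    congr 1
    refine Finset.sum_congr rfl fun m hm => ?_
    rw [Finset.mem_range] at hm
    rw [hG₁ m (by omega), hG₁ (m + 1) (by omega), hG₁ (m + 2) (by omega)]
    show turn (unshift w _) (unshift w _) (unshift w _) = _
    rw [turn_unshift_ST]
    exact turn_cpos β₁ _
  -- RIGHT-HAND SIDE: the difference chain is closed and supported on inner corners of `E`
  set Dl : List (Pt × Pt) := fwdPiece P₀ 0 (K₀ + 1) ++ bwdPiece P₁ 0 (K₁ + 1) with hDl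
  have hunit₁ : ∀ k < K₁ + 1, IsUnitStep (P₁ (0 + k)) (P₁ (0 + k + 1)) := fun k _ => by
    have := isDart_cornerDart ((cornerOrbit β₁ a' (0 + k)).1 - w, (cornerOrbit β₁ a' (0 + k)).2)
    rw [← hP₁d] at this
    exact this.isUnitStep
  have hΔ : ∀ F : Pt, (∑ m ∈ Finset.range (K₀ + 1), dartWnd (glueSeq P₀ K₀ Kp (M + 1) m, glueSeq P₀ K₀ Kp (M + 1) (m + 1)) F -
      ∑ m ∈ Finset.range (K₁ + 1), dartWnd (glueSeq P₁ K₁ Kp (M + 1) m, glueSeq P₁ K₁ Kp (M + 1) (m + 1)) F) = dwnd Dl F := by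
    intro F
    rw [hDl, dwnd, List.map_append, List.sum_append, ← dwnd, ← dwnd, dwnd_fwdPiece_SR, dwnd_bwdPiece_SR _ _ _ _ hunit₁]
    simp only [zero_add]
    rw [sub_eq_add_neg]
    congr 1
    · refine Finset.sum_congr rfl fun m hm => ?_
      rw [Finset.mem_range] at hm
      rw [hG₀ m (by omega), hG₀ (m + 1) (by omega)]
    · congr 1
      refine Finset.sum_congr rfl fun m hm => ?_
      rw [Finset.mem_range] at hm
      rw [hG₁ m (by omega), hG₁ (m + 1) (by omega)]
  have hclosedDl : ∀ g : Pt → ℤ, (Dl.map fun d => g d.2 - g d.1).sum = 0 := by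
    intro g
    rw [hDl, List.map_append, List.sum_append, fwdPiece_boundary_SR, bwdPiece_boundary_SR]
    simp only [zero_add]
    rw [← hK0₀, ← hK0₁, ← hKM₀, ← hKM₁]
    ring
  have hsuppDl : ∀ d ∈ Dl, ∃ p : Site 2 × Fin 4, E.IsInnerFace (cFace p) ∧
      (d = (cpos p, ((cpos p).1 + (cdir p.2).1, (cpos p).2 + (cdir p.2).2)) ∨ d = (((cpos p).1 + (cdir p.2).1, (cpos p).2 + (cdir p.2).2), cpos p)) := by
    intro d hd
    rw [hDl, List.mem_append] at hd
    rcases hd with hd | hd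
    · obtain ⟨k, hk, rfl⟩ := mem_fwdPiece_SR hd
      refine ⟨cornerOrbit β₀ a (0 + k), hin₀ _ (by omega), Or.inl ?_⟩
      rw [hP₀d]; rfl
    · obtain ⟨k, hk, rfl⟩ := mem_bwdPiece_SR hd
      refine ⟨((cornerOrbit β₁ a' (0 + k)).1 - w, (cornerOrbit β₁ a' (0 + k)).2), hinner₁ _ (by omega), Or.inr ?_⟩
      have e := hP₁d (0 + k)
      rw [cornerDart] at e
      rw [Prod.ext_iff] at e ⊢
      exact ⟨e.2, e.1⟩
  -- the LEFT face of the dart of `a` is the start vertex, a vertex of the outer face of `e_a`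
  have hda : (glueSeq P₀ K₀ Kp (M + 1) 0, glueSeq P₀ K₀ Kp (M + 1) 1) = cornerDart a := by
    rw [hG₀ 0 (by omega), hG₀ 1 (by omega), hP₀d 0]; rfl
  have hlf : dwnd Dl (lf (cornerDart a)) = 0 := by
    have h := (ufrs_exteriorWinding_ST D E hΩ hE Dl hsuppDl hclosedDl).2 a.1 (a.2 + 3) hpa_out
    rw [show cornerDart a = cornerDart (a.1, a.2) from rfl, lf_cornerDart]
    exact h
  -- the RIGHT face carries the same value: the dart of `a` occurs once in each arc
  have hrf : dwnd Dl (rf (cornerDart a)) = 0 := by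
    have hjump := dwnd_rf_sub_lf_ST Dl (unitStep_of_supported_ST hsuppDl) hclosedDl (cornerDart a).1 (cornerDart a).2
      (isDart_cornerDart a)
    rw [Prod.mk.eta] at hjump
    -- membership and non-membership in the two pieces
    have hd_fwd : cornerDart a ∈ fwdPiece P₀ 0 (K₀ + 1) := by
      rw [fwdPiece, List.mem_map]
      exact ⟨0, List.mem_range.2 (by omega), by rw [hP₀d]; rfl⟩
    have hrev_bwd : ((cornerDart a).2, (cornerDart a).1) ∈ bwdPiece P₁ 0 (K₁ + 1) := by
      rw [bwdPiece, List.mem_map]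
      refine ⟨0, List.mem_range.2 (by omega), ?_⟩
      have e := hP₁d 0
      rw [cornerOrbit_zero, ha'eq] at e
      simp only [add_sub_cancel_right, Prod.mk.eta] at e
      rw [Prod.ext_iff] at e ⊢
      exact ⟨e.2, e.1⟩
    have hd_bwd : cornerDart a ∉ bwdPiece P₁ 0 (K₁ + 1) := by
      intro hmem
      obtain ⟨k, hk, e⟩ := mem_bwdPiece_SR hmem
      have h1 := isDart_cornerDart a
      have h2 : IsDart (P₁ (0 + k)) (P₁ (0 + k + 1)) := by
        have := isDart_cornerDart ((cornerOrbit β₁ a' (0 + k)).1 - w, (cornerOrbit β₁ a' (0 + k)).2)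
        rw [← hP₁d] at this; exact this
      rw [e] at h1
      exact h2.not_swap h1
    have hrev_fwd : ((cornerDart a).2, (cornerDart a).1) ∉ fwdPiece P₀ 0 (K₀ + 1) := by
      intro hmem
      obtain ⟨k, hk, e⟩ := mem_fwdPiece_SR hmem
      have h1 := isDart_cornerDart a
      have h2 : IsDart (P₀ (0 + k)) (P₀ (0 + k + 1)) := isDart_cpos β₀ _
      rw [Prod.ext_iff] at e
      simp only at e
      rw [← e.1, ← e.2] at h2
      exact h1.not_swap h2
    -- both pieces are duplicate-free
    have hnd_fwd : (fwdPiece P₀ 0 (K₀ + 1)).Nodup := by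
      rw [fwdPiece]
      refine List.Nodup.map_on (fun k hk k' hk' h => ?_) List.nodup_range
      rw [List.mem_range] at hk hk'
      simp only [zero_add] at h
      rw [hP₀d, hP₀d] at h
      have hc := cornerDart_injective h
      by_contra hne
      rcases Nat.lt_or_gt_of_ne hne with hlt | hlt
      · exact cornerOrbit_ne hE ha hlt (fun j hj => hin₀ j (by omega)) hc
      · exact cornerOrbit_ne hE ha hlt (fun j hj => hin₀ j (by omega)) hc.symm
    have hnd_bwd : (bwdPiece P₁ 0 (K₁ + 1)).Nodup := by
      rw [bwdPiece]
      refine List.Nodup.map_on (fun k hk k' hk' h => ?_) List.nodup_range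
      rw [List.mem_range] at hk hk'
      simp only [zero_add] at h
      have h' : (P₁ k, P₁ (k + 1)) = (P₁ k', P₁ (k' + 1)) := by
        rw [Prod.ext_iff] at h ⊢; exact ⟨h.2, h.1⟩
      rw [hP₁d, hP₁d] at h'
      have hc := cornerDart_injective h'
      simp only [Prod.mk.injEq, sub_left_inj] at hc
      have hc' : cornerOrbit β₁ a' k = cornerOrbit β₁ a' k' := Prod.ext hc.1 hc.2
      by_contra hne
      rcases Nat.lt_or_gt_of_ne hne with hlt | hlt
      · exact cornerOrbit_ne hE₁ ha' hlt (fun j hj => hin₁ j (by omega)) hc'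
      · exact cornerOrbit_ne hE₁ ha' hlt (fun j hj => hin₁ j (by omega)) hc'.symm
    have c1 : Dl.count (cornerDart a) = 1 := by
      rw [hDl, List.count_append, List.count_eq_one_of_mem hnd_fwd hd_fwd, List.count_eq_zero_of_not_mem hd_bwd]
    have c2 : Dl.count ((cornerDart a).2, (cornerDart a).1) = 1 := by
      rw [hDl, List.count_append, List.count_eq_zero_of_not_mem hrev_fwd, List.count_eq_one_of_mem hnd_bwd hrev_bwd]
    rw [c1, c2, hlf] at hjump
    omega
  -- conclusion
  rw [hL₀, hL₁, hlast, hda, hΔ, hΔ, hlf, hrf] at key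
  omega


/-- **The START-pair offset is the offset of the two continuations** (corollary of Lemma A, same
configuration for both data). With the exit times `K₀ ≥ n`, `K₁ ≥ T` of the two full explorations:
`∑_{t<n} turnSign β₀ (O₀ a t) - ∑_{t<T} turnSign β₁ (O₁ a' t) = ∑_{T ≤ t < K₁} turnSign β₁ (O₁ a' t) - ∑_{n ≤ t < K₀} turnSign β₀ (O₀ a t)`
— in the final-merge configuration (`O₁ a' T = O₀ a n` deep in the ball) a nonzero offset of the two start
strands is a nonzero offset of the two continuations from the common deep corner to the exits. -/
theorem ufrs_startPair_offset_eq_continuations_ST {D : DobrushinDomain} {E : DiscreteDobrushin} (hΩ : E.Ω = D.carrier)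
    (hE : E.IsZdAdmissible) (w : Site 2) (ω : BondConfig (Site 2)) {a a' : Site 2 × Fin 4} {K₀ K₁ n T : ℕ}
    (ha : E.IsStartCorner a) (ha' : (shiftData E w).IsStartCorner a')
    (hin₀ : ∀ t ≤ K₀, E.IsInnerFace (cFace (cornerOrbit (E.bcBondConfig ω) a t)))
    (hout₀ : ¬ E.IsInnerFace (cFace (cornerOrbit (E.bcBondConfig ω) a (K₀ + 1))))
    (hin₁ : ∀ t ≤ K₁, (shiftData E w).IsInnerFace (cFace (cornerOrbit ((shiftData E w).bcBondConfig ω) a' t)))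
    (hout₁ : ¬ (shiftData E w).IsInnerFace (cFace (cornerOrbit ((shiftData E w).bcBondConfig ω) a' (K₁ + 1))))
    (hn : n ≤ K₀) (hT : T ≤ K₁) :
    ∑ t ∈ Finset.range n, turnSign (E.bcBondConfig ω) (cornerOrbit (E.bcBondConfig ω) a t) -
        ∑ t ∈ Finset.range T, turnSign ((shiftData E w).bcBondConfig ω) (cornerOrbit ((shiftData E w).bcBondConfig ω) a' t) =
      ∑ t ∈ Finset.Ico T K₁, turnSign ((shiftData E w).bcBondConfig ω) (cornerOrbit ((shiftData E w).bcBondConfig ω) a' t) -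
        ∑ t ∈ Finset.Ico n K₀, turnSign (E.bcBondConfig ω) (cornerOrbit (E.bcBondConfig ω) a t) := by
  have key := ufrs_canonicalTurning_ST D E hΩ hE w ω ω a a' K₀ K₁ ha ha' hin₀ hout₀ hin₁ hout₁
  rw [← Finset.sum_range_add_sum_Ico _ hn, ← Finset.sum_range_add_sum_Ico _ hT] at key
  linarith


/-- **Turning mismatch of the start strands ⟹ turning mismatch of the continuations** (the form consumed
with the UFRS hypotheses, turns in radians): if `∑_{t<T} turnOf β₁ (O₁ a' t) ≠ ∑_{t<n} turnOf β₀ (O₀ a t)` then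
the turn-sign sums of the two continuations `O₀ a [n, K₀)`, `O₁ a' [T, K₁)` to the exits differ. -/
theorem ufrs_continuations_turnSign_ne_ST {D : DobrushinDomain} {E : DiscreteDobrushin} (hΩ : E.Ω = D.carrier)
    (hE : E.IsZdAdmissible) (w : Site 2) (ω : BondConfig (Site 2)) {a a' : Site 2 × Fin 4} {K₀ K₁ n T : ℕ}
    (ha : E.IsStartCorner a) (ha' : (shiftData E w).IsStartCorner a')
    (hin₀ : ∀ t ≤ K₀, E.IsInnerFace (cFace (cornerOrbit (E.bcBondConfig ω) a t)))
    (hout₀ : ¬ E.IsInnerFace (cFace (cornerOrbit (E.bcBondConfig ω) a (K₀ + 1))))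
    (hin₁ : ∀ t ≤ K₁, (shiftData E w).IsInnerFace (cFace (cornerOrbit ((shiftData E w).bcBondConfig ω) a' t)))
    (hout₁ : ¬ (shiftData E w).IsInnerFace (cFace (cornerOrbit ((shiftData E w).bcBondConfig ω) a' (K₁ + 1))))
    (hn : n ≤ K₀) (hT : T ≤ K₁)
    (hne : ∑ t ∈ Finset.range T, turnOf ((shiftData E w).bcBondConfig ω) (cornerOrbit ((shiftData E w).bcBondConfig ω) a' t) ≠
      ∑ t ∈ Finset.range n, turnOf (E.bcBondConfig ω) (cornerOrbit (E.bcBondConfig ω) a t)) :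
    ∑ t ∈ Finset.Ico n K₀, turnSign (E.bcBondConfig ω) (cornerOrbit (E.bcBondConfig ω) a t) ≠
      ∑ t ∈ Finset.Ico T K₁, turnSign ((shiftData E w).bcBondConfig ω) (cornerOrbit ((shiftData E w).bcBondConfig ω) a' t) := by
  intro h
  have key := ufrs_startPair_offset_eq_continuations_ST hΩ hE w ω ha ha' hin₀ hout₀ hin₁ hout₁ hn hT
  rw [h, sub_self, sub_eq_zero] at key
  apply hne
  rw [sum_turnOf_eq, sum_turnOf_eq, ← Int.cast_sum, ← Int.cast_sum, key]

end

end Summit.CriticalPhenomena.CardyFormulaZ2.Cruxes.EdgePrecompact.QkzStripBoundaryArm
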